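import Summits.AtomisticToContinuum.Crystallization.Theorems.HullExactificationCascadeZeroDefectDensityHalfBound
import Summits.AtomisticToContinuum.Crystallization.Theses.HullExactificationCascade
import Summits.AtomisticToContinuum.Crystallization.Theorems.SquareWellLayerCakeStackingFaultSparsityOffBoxRef
import HarnessLib

/-!
# The half-bound rung at the certified level `0.7175`
# (crux `ZeroDefectDensity`, item stmt-AtomisticToContinuum-12086, line `birth`, lead c6)

Unconditional, explicit form of the half-bound rung of `…ZeroDefectDensityHalfBound.lean`:
the thermodynamic limit `e_∞ = lim E(N)/N` of the Lennard-Jones ground-state energy per particle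
in `ℝ³` satisfies `e_∞ ≤ -0.7175` (`hb_lim_le`: the route's PROVED trial-state bound
`CrysEnergyUpper_holds`, `limsup E(N)/N ≤ ⨅_Q e(Q)`, the PROVED `CrysPeriodicBddBelow_holds`, and the
tree's certified relaxed-hcp value `e(hcp(0.9713, 0.9713·0.8164)) ≤ -0.7175`,
`SquareWellLayerCake.StackingFaultSparsity.stub_offBoxRef`, all with the standard axioms), hence

* `hb_looseParticles_card_le_of_lt` — for every `τ < 0.7175` the number of particles of a
  Lennard-Jones ground state with site energy `≥ -τ` is bounded uniformly in `N`;
* `hb_tendsto_looseDensity_zero_of_lt` — and their density along any sequence of ground states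
  tends to `0`.

`0.7175` is half of the bulk site energy `2e_∞ ≈ -1.4352` up to `4·10⁻⁵`: almost every particle of a
Lennard-Jones ground state carries at least half of the bulk binding — the level at which
single-particle exchange is capped (strategist census of the crux, "Ladder ceiling").
-/

noncomputable section

namespace Summit.AtomisticToContinuum.Crystallization.Theorems.ZeroDefectDensityBirth

open Literature.MathematicalPhysics.StatisticalMechanics Filter Topology
open Summit.AtomisticToContinuum.Crystallization.Theses.HullExactificationCascade
  (CrysEnergyUpper_holds CrysPeriodicBddBelow_holds)

/-- **`e_∞ ≤ -0.7175`.** If `E(N)/N → e` for the Lennard-Jones ground-state energy in `ℝ³`, then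
`e ≤ -7175/10000`: `e = limsup E(N)/N ≤ ⨅_Q e(Q) ≤ e(hcp(0.9713, 0.9713·0.8164)) ≤ -0.7175`. -/
theorem hb_lim_le {e : ℝ}
    (he : Tendsto (fun N : ℕ => groundStateEnergy lennardJones 3 N / N) atTop (𝓝 e)) :
    e ≤ -(7175 / 10000) := by
  have h1 : limsup (fun N : ℕ => groundStateEnergy lennardJones 3 N / N) atTop = e :=
    he.limsup_eq
  have h2 := CrysEnergyUpper_holds
  unfold Summit.AtomisticToContinuum.Crystallization.Theses.HullExactificationCascade.CrysEnergyUpper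
    at h2
  rw [h1] at h2
  have ha : (9713 / 10000 : ℝ) ≠ 0 := by norm_num
  have hh : (9713 / 10000 * (8164 / 10000) : ℝ) ≠ 0 := by norm_num
  have h3 : (⨅ Q : PeriodicConfiguration 3, Q.energyPerParticle lennardJones) ≤
      (hcpPeriodicConfiguration ha hh).energyPerParticle lennardJones :=
    ciInf_le CrysPeriodicBddBelow_holds _
  have h4 := Summit.AtomisticToContinuum.Crystallization.Theorems.SquareWellLayerCake.StackingFaultSparsity.stub_offBoxRef ha hh
  linarith

/-- **`0.7175 ≤ -e_∞`** for `e_∞ := lim E(N)/N` (the limit exists: `BlancLewin2015_8_holds`). -/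
theorem hb_le_neg_lim :
    (7175 / 10000 : ℝ) ≤ -(limUnder atTop fun N : ℕ => groundStateEnergy lennardJones 3 N / N) := by
  obtain ⟨e, -, he, -⟩ := BlancLewin2015_8_holds 3 (by norm_num) (by norm_num)
  have hlim : Tendsto (fun N : ℕ => groundStateEnergy lennardJones 3 N / N) atTop
      (𝓝 (limUnder atTop fun N : ℕ => groundStateEnergy lennardJones 3 N / N)) :=
    tendsto_nhds_limUnder ⟨e, he⟩
  have h := hb_lim_le hlim
  linarith

/-- **HALF-BOUND RUNG, explicit: loose particles are bounded in number for every `τ < 0.7175`.**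
For every `τ < 7175/10000` there is `K` such that every Lennard-Jones ground state in `ℝ³`, of
any number `N` of particles, has at most `K` particles of site energy `≥ -τ`. -/
theorem hb_looseParticles_card_le_of_lt {τ : ℝ} (hτ : τ < 7175 / 10000) :
    ∃ K : ℝ, ∀ (N : ℕ) (x : Fin N → EuclideanSpace ℝ (Fin 3)), IsGroundState lennardJones x →
      ((Finset.univ.filter fun i => -τ ≤ siteEnergy lennardJones x i).card : ℝ) ≤ K :=
  hb_looseParticles_card_le_of_lt_neg_lim (hτ.trans_le hb_le_neg_lim)

/-- **HALF-BOUND RUNG, explicit a.e. form.** For every `τ < 7175/10000`, along every sequence of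
Lennard-Jones ground states in `ℝ³` the fraction of particles with site energy `≥ -τ` tends to
`0`. -/
theorem hb_tendsto_looseDensity_zero_of_lt {τ : ℝ} (hτ : τ < 7175 / 10000)
    (x : (N : ℕ) → (Fin N → EuclideanSpace ℝ (Fin 3)))
    (hx : ∀ N, IsGroundState lennardJones (x N)) :
    Tendsto (fun N : ℕ =>
      (Nat.card {i : Fin N // -τ ≤ siteEnergy lennardJones (x N) i} : ℝ) / N) atTop (𝓝 0) := by
  obtain ⟨e, -, he, -⟩ := BlancLewin2015_8_holds 3 (by norm_num) (by norm_num)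
  exact hb_tendsto_looseDensity_zero he (hτ.trans_le (by have := hb_lim_le he; linarith)) x hx

end Summit.AtomisticToContinuum.Crystallization.Theorems.ZeroDefectDensityBirth

end
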